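import Mathlib.Analysis.SpecialFunctions.Pow.Real
import Mathlib.Algebra.Order.BigOperators.Group.Finset
import Mathlib.Algebra.BigOperators.Ring.Finset
import HarnessLib

/-!
# `NoHeavyLowerTail` (stmt-CriticalPhenomena-4575) — the ratio-dominance calculus behind the MARK ⟹ MONO induction

Support file, seat `prim-l12-p5` (gen 20), `--supports stmt-CriticalPhenomena-4575`.  Standard axioms, no sorries, no named
facts, no new definitions (all hypotheses are explicit `∀ k` inequalities, as in the gen-19 file `…SahiFreeSlotRatioMono`).

Gen 19 reduced Conjecture P / COND_TOP (all orders, all pattern laws) to MONO: the consecutive ratios `s(k+1)/s(k)` of the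
cycle-count sequences `s_{(Y,X)}` decrease when the free set `X` grows.  Gen 20 (proof note INDUCTION-PROOF-g20.md §0–§3) derives
MONO, the deletion monotonicity DEL₁, log-concavity LC and SHIFT for all ground sets, by induction on the number of points, from a
single statement MARK, using only the elementary calculus of RATIO DOMINANCE of nonnegative sequences,
`a ≼ b :⟺ ∀ k, a(k+1)·b(k) ≤ a(k)·b(k+1)` (consecutive 2×2 minors; for positive sequences the likelihood-ratio order):
it is a convex-cone condition in each argument (`rdom_add_left/right`, `rdom_sum_left/right`), transitive under a support
condition (`rdom_trans`), log-concavity `s(k+2)s(k) ≤ s(k+1)²` is `s ≼ λs`, and a log-concave `s` satisfies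
`s ≼ (α + βλ)s` and `(α + βλ)s ≼ λs` (`rdom_affine_right`, `affine_rdom_shift`).  The two induction steps of Theorem 3.1
of the note are recorded abstractly: `lc_of_del_of_shift` (DEL₁ ∧ SHIFT ⟹ LC, Thm 3.1(d)) and `del_step` (Thm 3.1(a):
the three pieces `λx_v·s`, `P`, `R^v` of the insertion identity `s_{(Y+v,X)} = λx_v s + P + R^v` each dominate `s`, hence so
does their sum).  Here `(λa)(0) = 0`, `(λa)(k+1) = a(k)` is the index shift (multiplication of the generating polynomial by `λ`);
shifted sequences are passed as explicit sequences with their defining equations.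
[this work; folklore (likelihood-ratio order, cf. Shaked–Shanthikumar, *Stochastic Orders* (2007), §1.C; Karlin, *Total Positivity* (1968))]
-/

namespace Summit.CriticalPhenomena.PercolationContinuityZ3.Theorems

namespace SahiFreeSlot

open Finset

/-- Cone property of ratio dominance in the right argument: `a ≼ b₁`, `a ≼ b₂` ⟹ `a ≼ b₁ + b₂`. [folklore] -/
theorem rdom_add_right {a b₁ b₂ : ℕ → ℝ}
    (h₁ : ∀ k, a (k + 1) * b₁ k ≤ a k * b₁ (k + 1)) (h₂ : ∀ k, a (k + 1) * b₂ k ≤ a k * b₂ (k + 1)) :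
    ∀ k, a (k + 1) * (b₁ k + b₂ k) ≤ a k * (b₁ (k + 1) + b₂ (k + 1)) := by
  intro k
  have e1 := h₁ k
  have e2 := h₂ k
  nlinarith

/-- Cone property of ratio dominance in the left argument: `a₁ ≼ b`, `a₂ ≼ b` ⟹ `a₁ + a₂ ≼ b`. [folklore] -/
theorem rdom_add_left {a₁ a₂ b : ℕ → ℝ}
    (h₁ : ∀ k, a₁ (k + 1) * b k ≤ a₁ k * b (k + 1)) (h₂ : ∀ k, a₂ (k + 1) * b k ≤ a₂ k * b (k + 1)) :
    ∀ k, (a₁ (k + 1) + a₂ (k + 1)) * b k ≤ (a₁ k + a₂ k) * b (k + 1) := by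
  intro k
  have e1 := h₁ k
  have e2 := h₂ k
  nlinarith

/-- Scaling the right argument by `c ≥ 0` preserves ratio dominance. [folklore] -/
theorem rdom_smul_right {a b : ℕ → ℝ} (h : ∀ k, a (k + 1) * b k ≤ a k * b (k + 1)) {c : ℝ} (hc : 0 ≤ c) :
    ∀ k, a (k + 1) * (c * b k) ≤ a k * (c * b (k + 1)) := by
  intro k
  have e := mul_le_mul_of_nonneg_left (h k) hc
  nlinarith [e]

/-- Scaling the left argument by `c ≥ 0` preserves ratio dominance. [folklore] -/
theorem rdom_smul_left {a b : ℕ → ℝ} (h : ∀ k, a (k + 1) * b k ≤ a k * b (k + 1)) {c : ℝ} (hc : 0 ≤ c) :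
    ∀ k, (c * a (k + 1)) * b k ≤ (c * a k) * b (k + 1) := by
  intro k
  have e := mul_le_mul_of_nonneg_left (h k) hc
  nlinarith [e]

/-- Finite sums in the right argument: `a ≼ b i` for all `i ∈ S` ⟹ `a ≼ Σ_{i∈S} b i`. [folklore] -/
theorem rdom_sum_right {ι : Type*} (S : Finset ι) {a : ℕ → ℝ} {b : ι → ℕ → ℝ}
    (h : ∀ i ∈ S, ∀ k, a (k + 1) * b i k ≤ a k * b i (k + 1)) :
    ∀ k, a (k + 1) * (∑ i ∈ S, b i k) ≤ a k * (∑ i ∈ S, b i (k + 1)) := by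
  classical
  induction S using Finset.induction_on with
  | empty => intro k; simp
  | insert j S hj ih =>
    have h1 : ∀ k, a (k + 1) * b j k ≤ a k * b j (k + 1) := h j (mem_insert_self j S)
    have h2 := ih fun i hi => h i (mem_insert_of_mem hi)
    intro k
    simp only [sum_insert hj]
    exact rdom_add_right h1 h2 k

/-- Finite sums in the left argument: `a i ≼ b` for all `i ∈ S` ⟹ `Σ_{i∈S} a i ≼ b`. [folklore] -/
theorem rdom_sum_left {ι : Type*} (S : Finset ι) {a : ι → ℕ → ℝ} {b : ℕ → ℝ}
    (h : ∀ i ∈ S, ∀ k, a i (k + 1) * b k ≤ a i k * b (k + 1)) :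
    ∀ k, (∑ i ∈ S, a i (k + 1)) * b k ≤ (∑ i ∈ S, a i k) * b (k + 1) := by
  classical
  induction S using Finset.induction_on with
  | empty => intro k; simp
  | insert j S hj ih =>
    have h1 : ∀ k, a j (k + 1) * b k ≤ a j k * b (k + 1) := h j (mem_insert_self j S)
    have h2 := ih fun i hi => h i (mem_insert_of_mem hi)
    intro k
    simp only [sum_insert hj]
    have e1 := h1 k
    have e2 := h2 k
    nlinarith [e1, e2]

/-- Transitivity of ratio dominance for nonnegative sequences: `a ≼ b`, `b ≼ c` ⟹ `a ≼ c`, provided that wherever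
`b(k) = b(k+1) = 0` one has `a(k+1) = 0` or `c(k) = 0` (automatic for interval supports with nondecreasing endpoints,
INDUCTION-PROOF-g20 (L2)). [folklore] -/
theorem rdom_trans {a b c : ℕ → ℝ} (ha : ∀ k, 0 ≤ a k) (hb : ∀ k, 0 ≤ b k) (hc : ∀ k, 0 ≤ c k)
    (hab : ∀ k, a (k + 1) * b k ≤ a k * b (k + 1)) (hbc : ∀ k, b (k + 1) * c k ≤ b k * c (k + 1))
    (H : ∀ k, b k = 0 → b (k + 1) = 0 → a (k + 1) = 0 ∨ c k = 0) :
    ∀ k, a (k + 1) * c k ≤ a k * c (k + 1) := by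
  intro k
  have h1 := hab k
  have h2 := hbc k
  have hR : 0 ≤ a k * c (k + 1) := mul_nonneg (ha k) (hc (k + 1))
  by_cases hk : b k = 0
  · by_cases hk1 : b (k + 1) = 0
    · rcases H k hk hk1 with h | h
      · rw [h, zero_mul]; exact hR
      · rw [h, mul_zero]; exact hR
    · have hpos : 0 < b (k + 1) := lt_of_le_of_ne (hb (k + 1)) (Ne.symm hk1)
      have h3 : b (k + 1) * c k ≤ 0 := by rw [hk, zero_mul] at h2; exact h2
      have h3' : b (k + 1) * c k ≤ b (k + 1) * 0 := by simpa using h3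
      have hck : c k ≤ 0 := le_of_mul_le_mul_left h3' hpos
      have hck0 : c k = 0 := le_antisymm hck (hc k)
      rw [hck0, mul_zero]; exact hR
  · have hpos : 0 < b k := lt_of_le_of_ne (hb k) (Ne.symm hk)
    by_cases hk1 : b (k + 1) = 0
    · have h3 : a (k + 1) * b k ≤ 0 := by rw [hk1, mul_zero] at h1; exact h1
      have h3' : a (k + 1) * b k ≤ 0 * b k := by simpa using h3
      have hak : a (k + 1) ≤ 0 := le_of_mul_le_mul_right h3' hpos
      have hak0 : a (k + 1) = 0 := le_antisymm hak (ha (k + 1))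
      rw [hak0, zero_mul]; exact hR
    · have hpos1 : 0 < b (k + 1) := lt_of_le_of_ne (hb (k + 1)) (Ne.symm hk1)
      have h4 : (a (k + 1) * b k) * (b (k + 1) * c k) ≤ (a k * b (k + 1)) * (b k * c (k + 1)) :=
        mul_le_mul h1 h2 (mul_nonneg (hb (k + 1)) (hc k)) (mul_nonneg (ha k) (hb (k + 1)))
      have h5 : (b k * b (k + 1)) * (a (k + 1) * c k) ≤ (b k * b (k + 1)) * (a k * c (k + 1)) := by
        have e : (a (k + 1) * b k) * (b (k + 1) * c k) = (b k * b (k + 1)) * (a (k + 1) * c k) := by ring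
        have e' : (a k * b (k + 1)) * (b k * c (k + 1)) = (b k * b (k + 1)) * (a k * c (k + 1)) := by ring
        rw [← e, ← e']; exact h4
      exact le_of_mul_le_mul_left h5 (mul_pos hpos hpos1)

/-- A log-concave sequence is ratio-dominated by its affine shifts: if `s(k+2)s(k) ≤ s(k+1)²` for all `k` and `α, β ≥ 0`,
then `s ≼ T` for the sequence `T = (α + βλ)s`, i.e. `T(0) = α s(0)`, `T(k+1) = α s(k+1) + β s(k)` (any real `α`; the `α`-terms cancel)
(INDUCTION-PROOF-g20 (L3), first half). [this work; folklore] -/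
theorem rdom_affine_right {s T : ℕ → ℝ} (hs : ∀ k, 0 ≤ s k) (hlc : ∀ k, s (k + 2) * s k ≤ s (k + 1) * s (k + 1))
    {α β : ℝ} (hβ : 0 ≤ β) (hT0 : T 0 = α * s 0) (hT : ∀ k, T (k + 1) = α * s (k + 1) + β * s k) :
    ∀ k, s (k + 1) * T k ≤ s k * T (k + 1) := by
  intro k
  cases k with
  | zero =>
    rw [hT0, hT 0]
    nlinarith [hs 0, hs 1, mul_nonneg hβ (mul_nonneg (hs 0) (hs 0))]
  | succ k =>
    rw [hT k, hT (k + 1)]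
    have e := mul_le_mul_of_nonneg_left (hlc k) hβ
    nlinarith [e]

/-- For a log-concave nonnegative `s` and `α, β ≥ 0`, the affine shift `T = (α + βλ)s` is ratio-dominated by `λs`:
`T(k+2)·s(k) ≤ T(k+1)·s(k+1)` (any real `β`; the `β`-terms cancel) (INDUCTION-PROOF-g20 (L3), second half; the index-`0` minor is
`T(1)·0 ≤ T(0)·s(0)`). [this work; folklore] -/
theorem affine_rdom_shift {s T : ℕ → ℝ} (hlc : ∀ k, s (k + 2) * s k ≤ s (k + 1) * s (k + 1))
    {α β : ℝ} (hα : 0 ≤ α) (hT : ∀ k, T (k + 1) = α * s (k + 1) + β * s k) :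
    ∀ k, T (k + 2) * s k ≤ T (k + 1) * s (k + 1) := by
  intro k
  rw [hT (k + 1), hT k]
  have e := mul_le_mul_of_nonneg_left (hlc k) hα
  nlinarith [e]

/-- **The LC step of the induction** (INDUCTION-PROOF-g20 Thm 3.1(d)).  Let `s' ≥ 0` (the row of the smaller ground set) and
`s ≥ 0` (the bigger row) satisfy DEL₁ `s' ≼ s` and SHIFT `s ≼ λs'` (`s(k+2)s'(k) ≤ s(k+1)s'(k+1)`), and suppose that where
`s'(k) = s'(k+1) = 0` one has `s(k+2) = 0` or `s(k) = 0` (true for interval supports).  Then `s` is log-concave. [this work] -/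
theorem lc_of_del_of_shift {s s' : ℕ → ℝ} (hs : ∀ k, 0 ≤ s k) (hs' : ∀ k, 0 ≤ s' k)
    (hdel : ∀ k, s' (k + 1) * s k ≤ s' k * s (k + 1)) (hshift : ∀ k, s (k + 2) * s' k ≤ s (k + 1) * s' (k + 1))
    (H : ∀ k, s' k = 0 → s' (k + 1) = 0 → s (k + 2) = 0 ∨ s k = 0) :
    ∀ k, s (k + 2) * s k ≤ s (k + 1) * s (k + 1) := by
  intro k
  have h1 := hshift k
  have h2 := hdel k
  have hR : 0 ≤ s (k + 1) * s (k + 1) := mul_nonneg (hs (k + 1)) (hs (k + 1))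
  by_cases hk : s' k = 0
  · by_cases hk1 : s' (k + 1) = 0
    · rcases H k hk hk1 with h | h
      · rw [h, zero_mul]; exact hR
      · rw [h, mul_zero]; exact hR
    · have hpos : 0 < s' (k + 1) := lt_of_le_of_ne (hs' (k + 1)) (Ne.symm hk1)
      have h3 : s' (k + 1) * s k ≤ 0 := by rw [hk, zero_mul] at h2; exact h2
      have h3' : s' (k + 1) * s k ≤ s' (k + 1) * 0 := by simpa using h3
      have hsk : s k ≤ 0 := le_of_mul_le_mul_left h3' hpos
      have hsk0 : s k = 0 := le_antisymm hsk (hs k)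
      rw [hsk0, mul_zero]; exact hR
  · have hpos : 0 < s' k := lt_of_le_of_ne (hs' k) (Ne.symm hk)
    by_cases hk1 : s' (k + 1) = 0
    · have h3 : s (k + 2) * s' k ≤ 0 := by rw [hk1, mul_zero] at h1; exact h1
      have h3' : s (k + 2) * s' k ≤ 0 * s' k := by simpa using h3
      have hsk : s (k + 2) ≤ 0 := le_of_mul_le_mul_right h3' hpos
      have hsk0 : s (k + 2) = 0 := le_antisymm hsk (hs (k + 2))
      rw [hsk0, zero_mul]; exact hR
    · have hpos1 : 0 < s' (k + 1) := lt_of_le_of_ne (hs' (k + 1)) (Ne.symm hk1)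
      have h4 : (s (k + 2) * s' k) * (s' (k + 1) * s k) ≤ (s (k + 1) * s' (k + 1)) * (s' k * s (k + 1)) :=
        mul_le_mul h1 h2 (mul_nonneg (hs' (k + 1)) (hs k)) (mul_nonneg (hs (k + 1)) (hs' (k + 1)))
      have h5 : (s' k * s' (k + 1)) * (s (k + 2) * s k) ≤ (s' k * s' (k + 1)) * (s (k + 1) * s (k + 1)) := by
        have e : (s (k + 2) * s' k) * (s' (k + 1) * s k) = (s' k * s' (k + 1)) * (s (k + 2) * s k) := by ring
        have e' : (s (k + 1) * s' (k + 1)) * (s' k * s (k + 1)) = (s' k * s' (k + 1)) * (s (k + 1) * s (k + 1)) := by ring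
        rw [← e, ← e']; exact h4
      exact le_of_mul_le_mul_left h5 (mul_pos hpos hpos1)

/-- **The DEL₁ step of the induction** (INDUCTION-PROOF-g20 Thm 3.1(a), case (I2)).  If `s ≥ 0` is log-concave, and `s ≼ P`
(from MONO: the expected number of paid points is nondecreasing) and `s ≼ R` (MARK), then `s ≼ T` for
`T = λx·s + P + R` (`T(0) = P(0) + R(0)`, `T(k+1) = x·s(k) + P(k+1) + R(k+1)`, `x ≥ 0`), which by the insertion identity
`s_{(Y+v,X)} = λx_v·s_{(Y,X)} + P + R^v` is DEL₁: `s_{(Y,X)} ≼ s_{(Y+v,X)}`. [this work] -/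
theorem del_step {s P R T : ℕ → ℝ} (hs : ∀ k, 0 ≤ s k) (hlc : ∀ k, s (k + 2) * s k ≤ s (k + 1) * s (k + 1))
    (hP : ∀ k, s (k + 1) * P k ≤ s k * P (k + 1)) (hR : ∀ k, s (k + 1) * R k ≤ s k * R (k + 1))
    {x : ℝ} (hx : 0 ≤ x) (hT0 : T 0 = P 0 + R 0) (hT : ∀ k, T (k + 1) = x * s k + P (k + 1) + R (k + 1)) :
    ∀ k, s (k + 1) * T k ≤ s k * T (k + 1) := by
  -- the piece λx·s: U(0) = 0, U(k+1) = x s(k)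
  have hU : ∀ k, s (k + 1) * (if k = 0 then 0 else x * s (k - 1)) ≤ s k * (x * s k) := by
    intro k
    cases k with
    | zero => simp only [if_true]; nlinarith [hs 0, mul_nonneg hx (mul_nonneg (hs 0) (hs 0))]
    | succ k =>
      simp only [Nat.succ_ne_zero, if_false, Nat.succ_sub_one]
      have e := mul_le_mul_of_nonneg_left (hlc k) hx
      nlinarith [e]
  intro k
  cases k with
  | zero =>
    rw [hT0, hT 0]
    have e0 := hU 0
    have e1 := hP 0
    have e2 := hR 0
    simp only [if_true] at e0
    nlinarith [e0, e1, e2, hs 0, mul_nonneg hx (mul_nonneg (hs 0) (hs 0))]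
  | succ k =>
    rw [hT k, hT (k + 1)]
    have e0 := hU (k + 1)
    have e1 := hP (k + 1)
    have e2 := hR (k + 1)
    simp only [Nat.succ_ne_zero, if_false, Nat.succ_sub_one] at e0
    nlinarith [e0, e1, e2]


/-! ### The induction step of INDUCTION-PROOF-g20 Theorem 3.1, assembled (gen 20, second instalment)

With `sY = s_{(Y,X)}` (ground set of `n` points), `sG` the row of `G = Y + v`, `R = R^v_{(Y,X)}` given as a nonnegative
combination `R(k+1) = Σ_i c_i·d_i(k)` of the deleted rows `d_i = s_{(Y∖B_i, X∖B_i)}` (`c_i = |B_i|!·y^v_{B_i} ≥ 0`), the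
insertion identity (I1) `sG = (n+1+λx_v)·sY + R` (case `v ∈ X_G`) resp. (I2) `sG = λx_v·sY + P + R` with
`P = (n−|X|)·sY + Σ_w s_{(Y,X∖w)}` (case `v ∉ X_G`), and the hypotheses LC(sY), MARK (`sY ≼ R`), DEL_n (`d_i ≼ sY`),
MONO_n (`sY ≼ s_{(Y,X∖w)}`), the conclusions DEL₁ (`sY ≼ sG`), SHIFT (`sG ≼ λ·sY`) and LC(sG) follow. -/

/-- From DEL at the smaller size (`d_i ≼ sY` for every deleted row) the remainder `R`, `R(k+1) = Σ_i c_i d_i(k)` with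
`c_i ≥ 0`, satisfies `R ≼ λ·sY`: `R(k+2)·sY(k) ≤ R(k+1)·sY(k+1)` (INDUCTION-PROOF-g20 Thm 3.1(d)). [this work] -/
theorem remainder_rdom_shift {ι : Type*} (S : Finset ι) {sY R : ℕ → ℝ} {c : ι → ℝ} {d : ι → ℕ → ℝ}
    (hc : ∀ i ∈ S, 0 ≤ c i) (hR : ∀ k, R (k + 1) = ∑ i ∈ S, c i * d i k)
    (hDEL : ∀ i ∈ S, ∀ k, d i (k + 1) * sY k ≤ d i k * sY (k + 1)) :
    ∀ k, R (k + 2) * sY k ≤ R (k + 1) * sY (k + 1) := by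
  have h := rdom_sum_left S (a := fun i k => c i * d i k) (b := sY)
    (fun i hi => rdom_smul_left (hDEL i hi) (hc i hi))
  intro k
  rw [hR (k + 1), hR k]
  exact h k

/-- **DEL₁, case (I1)** (`v ∈ X_G`): if `sG(0) = (n+1)·sY(0) + R(0)`, `sG(k+1) = (n+1)·sY(k+1) + x·sY(k) + R(k+1)` with
`x ≥ 0`, `sY ≥ 0` log-concave and `sY ≼ R` (MARK), then `sY ≼ sG`. [this work] -/
theorem del_one_I1 {sY sG R : ℕ → ℝ} {n x : ℝ} (hx : 0 ≤ x) (hs : ∀ k, 0 ≤ sY k)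
    (hlc : ∀ k, sY (k + 2) * sY k ≤ sY (k + 1) * sY (k + 1))
    (hmark : ∀ k, sY (k + 1) * R k ≤ sY k * R (k + 1))
    (hG0 : sG 0 = (n + 1) * sY 0 + R 0) (hG : ∀ k, sG (k + 1) = (n + 1) * sY (k + 1) + x * sY k + R (k + 1)) :
    ∀ k, sY (k + 1) * sG k ≤ sY k * sG (k + 1) := by
  intro k
  cases k with
  | zero =>
    rw [hG0, hG 0]
    have e := hmark 0
    nlinarith [hs 0, mul_nonneg hx (mul_nonneg (hs 0) (hs 0))]
  | succ k =>
    rw [hG k, hG (k + 1)]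
    have e1 := hmark (k + 1)
    have e2 := mul_le_mul_of_nonneg_left (hlc k) hx
    nlinarith [e1, e2]

/-- **SHIFT, case (I1)**: under the identity of `del_one_I1`, LC(sY) and `R ≼ λ·sY` (from `remainder_rdom_shift`),
`sG ≼ λ·sY`: `sG(k+2)·sY(k) ≤ sG(k+1)·sY(k+1)`. [this work] -/
theorem shift_I1 {sY sG R : ℕ → ℝ} {n x : ℝ} (hn : 0 ≤ n)
    (hlc : ∀ k, sY (k + 2) * sY k ≤ sY (k + 1) * sY (k + 1))
    (hRs : ∀ k, R (k + 2) * sY k ≤ R (k + 1) * sY (k + 1))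
    (hG : ∀ k, sG (k + 1) = (n + 1) * sY (k + 1) + x * sY k + R (k + 1)) :
    ∀ k, sG (k + 2) * sY k ≤ sG (k + 1) * sY (k + 1) := by
  intro k
  rw [hG (k + 1), hG k]
  have e1 := hRs k
  have e2 : 0 ≤ (n + 1) * (sY (k + 1) * sY (k + 1) - sY (k + 2) * sY k) :=
    mul_nonneg (by linarith) (by linarith [hlc k])
  nlinarith [e1, e2]

/-- **LC, case (I1)**: with the hypotheses of `del_one_I1` and `shift_I1`, nonnegativity of `sG` and the support condition of
`lc_of_del_of_shift`, the bigger row `sG` is log-concave (INDUCTION-PROOF-g20 Thm 3.1(d)). [this work] -/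
theorem lc_I1 {sY sG R : ℕ → ℝ} {n x : ℝ} (hn : 0 ≤ n) (hx : 0 ≤ x) (hs : ∀ k, 0 ≤ sY k) (hGpos : ∀ k, 0 ≤ sG k)
    (hlc : ∀ k, sY (k + 2) * sY k ≤ sY (k + 1) * sY (k + 1))
    (hmark : ∀ k, sY (k + 1) * R k ≤ sY k * R (k + 1))
    (hRs : ∀ k, R (k + 2) * sY k ≤ R (k + 1) * sY (k + 1))
    (hG0 : sG 0 = (n + 1) * sY 0 + R 0) (hG : ∀ k, sG (k + 1) = (n + 1) * sY (k + 1) + x * sY k + R (k + 1))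
    (H : ∀ k, sY k = 0 → sY (k + 1) = 0 → sG (k + 2) = 0 ∨ sG k = 0) :
    ∀ k, sG (k + 2) * sG k ≤ sG (k + 1) * sG (k + 1) :=
  lc_of_del_of_shift hGpos hs (del_one_I1 hx hs hlc hmark hG0 hG) (shift_I1 hn hlc hRs hG) H

/-- **`sY ≼ P`** from MONO at the smaller size: `P = m·sY + Σ_{w} s_w` with `m ≥ 0` and `sY ≼ s_w` for each `w`
(the identity `P_{(Y,X)} = (n−|X|)·s_{(Y,X)} + Σ_{w∈X} s_{(Y,X∖w)}` of the note, §2). [this work] -/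
theorem rdom_paid_points {ι : Type*} (S : Finset ι) {sY P : ℕ → ℝ} {sw : ι → ℕ → ℝ} {m : ℝ}
    (hP : ∀ k, P k = m * sY k + ∑ w ∈ S, sw w k)
    (hmono : ∀ w ∈ S, ∀ k, sY (k + 1) * sw w k ≤ sY k * sw w (k + 1)) :
    ∀ k, sY (k + 1) * P k ≤ sY k * P (k + 1) := by
  have h1 : ∀ k, sY (k + 1) * (m * sY k) ≤ sY k * (m * sY (k + 1)) := by
    intro k; nlinarith
  have h2 := rdom_sum_right S (a := sY) (b := sw) hmono
  intro k
  rw [hP k, hP (k + 1)]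
  have e1 := h1 k
  have e2 := h2 k
  nlinarith [e1, e2]

/-- **DEL₁, case (I2)** (`v ∉ X_G`): `sG(0) = P(0) + R(0)`, `sG(k+1) = x·sY(k) + P(k+1) + R(k+1)`, with LC(sY),
`sY ≼ P` (`rdom_paid_points`) and MARK `sY ≼ R`; then `sY ≼ sG`. [this work] -/
theorem del_one_I2 {sY sG P R : ℕ → ℝ} {x : ℝ} (hx : 0 ≤ x) (hs : ∀ k, 0 ≤ sY k)
    (hlc : ∀ k, sY (k + 2) * sY k ≤ sY (k + 1) * sY (k + 1))
    (hP : ∀ k, sY (k + 1) * P k ≤ sY k * P (k + 1)) (hmark : ∀ k, sY (k + 1) * R k ≤ sY k * R (k + 1))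
    (hG0 : sG 0 = P 0 + R 0) (hG : ∀ k, sG (k + 1) = x * sY k + P (k + 1) + R (k + 1)) :
    ∀ k, sY (k + 1) * sG k ≤ sY k * sG (k + 1) :=
  del_step hs hlc hP hmark hx hG0 hG

/-- **The MONO step** (INDUCTION-PROOF-g20 Thm 3.1(c)): if `s_{(G,X)} = s_{(G,X∖w)} + Σ_C e_C` and every piece satisfies
`e_C ≼ s_{(G,X∖w)}` (DEL at the current size), then `s_{(G,X)} ≼ s_{(G,X∖w)}`. [this work] -/
theorem mono_step {ι : Type*} (S : Finset ι) {sX sXw : ℕ → ℝ} {e : ι → ℕ → ℝ}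
    (hdec : ∀ k, sX k = sXw k + ∑ C ∈ S, e C k)
    (hdel : ∀ C ∈ S, ∀ k, e C (k + 1) * sXw k ≤ e C k * sXw (k + 1)) :
    ∀ k, sX (k + 1) * sXw k ≤ sX k * sXw (k + 1) := by
  have h := rdom_sum_left S (a := e) (b := sXw) hdel
  intro k
  rw [hdec (k + 1), hdec k]
  have e1 := h k
  nlinarith [e1]

end SahiFreeSlot


end Summit.CriticalPhenomena.PercolationContinuityZ3.Theorems
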